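import Summits.HodgeConjecture.HodgeConjecture.Theses.CyclicUnitaryPowers
import Summits.HodgeConjecture.HodgeConjecture.Theorems.CyclicUnitaryPowersPairTensorRational
import Summits.HodgeConjecture.HodgeConjecture.Theorems.CyclicUnitaryPowersHodgeFixedLine
import Summits.HodgeConjecture.HodgeConjecture.Theorems.CyclicUnitaryPowersPrimitiveRootTransfer
import Summits.HodgeConjecture.HodgeConjecture.Theorems.CyclicUnitaryPowersDeckUnitaryCommutatorGeneration
import Literature.AlgebraicGeometry.Motives.MumfordTateInvariantsBaseChange

/-!
# Stub L of line `unitary-kunneth-fft` (K2-A v6): deck-unitary invariants are spanned by the cyclic matching tensors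

Crux `PowersHodgeOfDeckCommutators` (stmt-HodgeConjecture-19545, route `CyclicUnitaryPowers`), registered stub
`stub_deckUnitaryInvariantsMatching` (lane 2): a rational tensor `t ∈ T^{r,0}(V)` whose complexification is fixed by
the connected deck-unitary group `U⁰ = {γ ∈ GL(V_ℂ) : γ s = s γ, γ ∈ O(Q_ℂ), γ|_{V^s} = 1}` lies in the `ℚ`-span of
the CYCLIC MATCHING TENSORS (pairs of slots filled with `(s^k ⊗ 1)(Casimir Q)`, free slots with `s`-fixed vectors).

Proof (Goodman–Wallach Thm. 5.3.1, coloured, via the tree's `TensorFFTGeneralLinear`): in the eigen-adapted basis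
`f` of `V_ℂ` (`CyclicUnitaryPowersEigenDualBasis`) the block elements `GL(E_j) ↪ U⁰` act on the pattern coordinates
of `x = ι t` by coloured Kronecker products (`CyclicUnitaryPowersBlockAction`, `…PatternWords`), so each pattern
component of `x` is a combination of pair tensors (`…PairPlacement`); the pair tensors are complex combinations of
complexified rational matching tensors (`…CasimirMatrix`, `…PairTensorRational`); descent to `ℚ`
(`MumfordTateInvariantsBaseChange`).

* §1 (any field of characteristic `0`) regrouping words by pattern and `mem_span_pairTensor`;
* §2 the stub over `ℚ`/`ℂ`.
-/

noncomputable section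

open Module Matrix
open scoped TensorProduct PiTensorProduct BigOperators

namespace Summit.HodgeConjecture.HodgeConjecture.Theorems.CyclicUnitaryPowersDeckUnitaryInvariantsMatching

open Literature.AlgebraicGeometry.Motives
open Literature.RepresentationTheory.GeneralLinear (wordRepAt)
open Literature.RepresentationTheory.ClassicalInvariants (contractionTensor mixedFamily
  mem_span_contractionTensor_of_forall_wordRepAt_mixedFamily_eq)
open Summit.HodgeConjecture.HodgeConjecture.Theorems.CyclicUnitaryPowersSpectralProjectors
open Summit.HodgeConjecture.HodgeConjecture.Theorems.CyclicUnitaryPowersEigenPairing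
open Summit.HodgeConjecture.HodgeConjecture.Theorems.CyclicUnitaryPowersEigenDualBasis
open Summit.HodgeConjecture.HodgeConjecture.Theorems.CyclicUnitaryPowersBlockAction
open Summit.HodgeConjecture.HodgeConjecture.Theorems.CyclicUnitaryPowersPatternWords
open Summit.HodgeConjecture.HodgeConjecture.Theorems.CyclicUnitaryPowersPairPlacement
open Summit.HodgeConjecture.HodgeConjecture.Theorems.CyclicUnitaryPowersPairTensorRational
open Summit.HodgeConjecture.HodgeConjecture.Theorems.CyclicUnitaryPowersDeckUnitaryGroup
open Summit.HodgeConjecture.HodgeConjecture.Theorems.CyclicUnitaryPowersDeckUnitaryCommutatorsFix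
open Summit.HodgeConjecture.HodgeConjecture.Theorems.CyclicUnitaryPowersDeckUnitaryCommutatorGeneration
open Summit.HodgeConjecture.HodgeConjecture.Theorems.CyclicUnitaryPowersHodgeFixedLine
open Summit.HodgeConjecture.HodgeConjecture.Theorems.CyclicUnitaryPowersPrimitiveRootTransfer

/-! ### §1 Regrouping by pattern and the span of the pair tensors -/

section Generic

variable {K : Type*} [Field K] {W : Type*} [AddCommGroup W] [Module K W] {h n : ℕ}
  (f : Basis (Option (Fin h × Bool × Fin n)) K W) {r : ℕ}

/-- The standard enumeration of the positions off `E_0` of a pattern. [folklore] -/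
def stdEnum (κ : Fin r → Option (Fin h × Bool)) :
    Fin (Fintype.card {q : Fin r // (κ q).isSome}) ≃ {q : Fin r // (κ q).isSome} :=
  (Fintype.equivFin _).symm

/-- Synthesis of a tensor of pattern `κ` from block-coordinate coefficients (linear). [folklore] -/
def wordSynth (κ : Fin r → Option (Fin h × Bool)) {d : ℕ} (e : Fin d ≃ {q : Fin r // (κ q).isSome}) :
    ((Fin d → Fin n) → K) →ₗ[K] hodgeTensorSpaceOver K W r 0 where
  toFun c := ∑ ν, c ν • tmon f (embWord κ e ν)
  map_add' c c' := by simp only [Pi.add_apply, add_smul, Finset.sum_add_distrib]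
  map_smul' a c := by simp only [Pi.smul_apply, smul_eq_mul, mul_smul, Finset.smul_sum, RingHom.id_apply]

/-- Unfolding lemma. [folklore] -/
theorem wordSynth_apply (κ : Fin r → Option (Fin h × Bool)) {d : ℕ} (e : Fin d ≃ {q : Fin r // (κ q).isSome})
    (c : (Fin d → Fin n) → K) : wordSynth f κ e c = ∑ ν, c ν • tmon f (embWord κ e ν) := rfl

/-- The synthesis of a contraction tensor is the pair tensor. [folklore] -/
theorem wordSynth_contractionTensor (κ : Fin r → Option (Fin h × Bool)) {d : ℕ} (e : Fin d ≃ {q : Fin r // (κ q).isSome})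
    (β : {k : Fin d // patTy κ e k = true} ≃ {k : Fin d // patTy κ e k = false}) :
    wordSynth f κ e (contractionTensor K (patTy κ e) β) = pairTensor f κ e β := rfl

/-- **Regrouping a sum over words by pattern.** [folklore] -/
theorem sum_regroup {M : Type*} [AddCommMonoid M] (F : (Fin r → Option (Fin h × Bool × Fin n)) → M) :
    ∑ w, F w = ∑ κ : Fin r → Option (Fin h × Bool), ∑ ν : Fin (Fintype.card {q : Fin r // (κ q).isSome}) → Fin n,
      F (embWord κ (stdEnum κ) ν) := by
  classical
  have h1 : ∀ w : Fin r → Option (Fin h × Bool × Fin n),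
      F w = ∑ κ : Fin r → Option (Fin h × Bool), if (fun q => shape (w q)) = κ then F w else 0 := fun w => by
    rw [Finset.sum_ite_eq Finset.univ (fun q => shape (w q)), if_pos (Finset.mem_univ _)]
  rw [Finset.sum_congr rfl fun w _ => h1 w, Finset.sum_comm]
  refine Finset.sum_congr rfl fun κ _ => ?_
  let G : (Fin r → Option (Fin h × Bool × Fin n)) → M := fun w => if (fun q => shape (w q)) = κ then F w else 0
  have hG : ∀ w, w ∉ Set.range (embWord (n := n) κ (stdEnum κ)) → G w = 0 := fun w hw =>
    if_neg fun hκ => hw (exists_embWord_of_shape κ (stdEnum κ) fun q => congrFun hκ q)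
  refine (Literature.RepresentationTheory.ClassicalInvariants.sum_eq_sum_comp_of_injective _
    (embWord_injective κ (stdEnum κ)) G hG).trans (Finset.sum_congr rfl fun ν _ => ?_)
  exact if_pos (funext fun q => shape_embWord κ (stdEnum κ) ν q)

/-- **A tensor is the sum of the syntheses of its pattern coordinates.** [folklore] -/
theorem eq_sum_wordSynth (x : hodgeTensorSpaceOver K W r 0) :
    x = ∑ κ : Fin r → Option (Fin h × Bool), wordSynth f κ (stdEnum κ) (patternCoord f κ (stdEnum κ) x) := by
  conv_lhs => rw [← sum_tcoord_smul_tmon f x]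
  rw [sum_regroup]
  rfl

/-- **FFT step**: a tensor fixed by (matrix realisations of) all single-colour block elements is a combination of
pair tensors of colour-preserving matchings. [cite: GoodmanWallachGTM255, Thm. 5.3.1] -/
theorem mem_span_pairTensor [CharZero K] (x : hodgeTensorSpaceOver K W r 0)
    (hx : ∀ (i : Fin h) (g : GL (Fin n) K), ∃ γ : W ≃ₗ[K] W, IsBlockElem f i g γ ∧ tensorSpaceActOver γ x = x) :
    x ∈ Submodule.span K {y : hodgeTensorSpaceOver K W r 0 | ∃ (κ : Fin r → Option (Fin h × Bool))
      (β : {k // patTy κ (stdEnum κ) k = true} ≃ {k // patTy κ (stdEnum κ) k = false}),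
      (∀ a, patCol κ (stdEnum κ) (β a) = patCol κ (stdEnum κ) a) ∧ y = pairTensor f κ (stdEnum κ) β} := by
  classical
  rw [eq_sum_wordSynth f x]
  refine Submodule.sum_mem _ fun κ _ => ?_
  have hc := mem_span_contractionTensor_of_forall_wordRepAt_mixedFamily_eq (patCol κ (stdEnum κ)) (patTy κ (stdEnum κ))
    (patternCoord f κ (stdEnum κ) x) fun g =>
      wordRepAt_mixedFamily_eq_of_single _ _ _ (fun i g' => by
        obtain ⟨γ, hγ, hγx⟩ := hx i g'
        exact wordRepAt_patternCoord_of_fixed hγ hγx) g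
  have himg := Submodule.mem_map_of_mem (f := wordSynth f κ (stdEnum κ)) hc
  rw [Submodule.map_span] at himg
  refine Submodule.span_mono ?_ himg
  rintro _ ⟨c, ⟨β, hβ, rfl⟩, rfl⟩
  exact ⟨κ, β, hβ, wordSynth_contractionTensor f κ _ β⟩

end Generic

/-! ### §2 The stub -/

/-- `1 ⊗ v ≠ 0` for `v ≠ 0`. [folklore] -/
theorem one_tmul_ne_zero {V : Type} [AddCommGroup V] [Module ℚ V] [Module.Finite ℚ V] {v : V} (hv : v ≠ 0) :
    ((1 : ℂ) ⊗ₜ[ℚ] v : ℂ ⊗[ℚ] V) ≠ 0 := by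
  intro h0
  apply hv
  apply (Module.finBasis ℚ V).repr.injective
  rw [map_zero]
  ext α
  have h := basis_repr_one_tmul v α
  rw [h0, map_zero, Finsupp.zero_apply] at h
  rw [Finsupp.zero_apply]
  exact (algebraMap ℚ ℂ).injective (by rw [map_zero]; exact h.symm)

/-- **Stub L** `stub_deckUnitaryInvariantsMatching` of the K2-A skeleton v6 (line `unitary-kunneth-fft`, lane 2):
the rational `U⁰`-invariant tensors in `T^{r,0}(V)` are spanned by the cyclic matching tensors.
[cite: GoodmanWallachGTM255, Thm. 5.3.1] -/
theorem stub_deckUnitaryInvariantsMatching :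
    open Literature.AlgebraicGeometry.Motives Literature.AlgebraicGeometry.HodgeTheory Literature.AlgebraicGeometry.HodgeTheory.BettiUniverse CategoryTheory.Limits in ∀ (V : Type) [AddCommGroup V] [Module ℚ V] [Module.Finite ℚ V] (Q : LinearMap.BilinForm ℚ V) (s : V →ₗ[ℚ] V) (p : ℕ), p.Prime → 3 ≤ p → Q.Nondegenerate → (∀ x y, Q x y = Q y x) → s ^ p = 1 → (∀ x y, Q (s x) (s y) = Q x y) → Module.finrank ℚ ↥(Module.End.eigenspace s 1) = 1 → ∀ (r : ℕ) (t : hodgeTensorSpace V r 0), (∀ γ : (ℂ ⊗[ℚ] V) ≃ₗ[ℂ] (ℂ ⊗[ℚ] V), (∀ x, γ ((s.baseChange ℂ) x) = (s.baseChange ℂ) (γ x)) → (∀ x y, (LinearMap.BilinForm.baseChange ℂ Q) (γ x) (γ y) = (LinearMap.BilinForm.baseChange ℂ Q) x y) → (∀ x, (s.baseChange ℂ) x = x → γ x = x) → tensorSpaceActOver γ (tensorSpaceToBaseChange ℂ V r 0 t) = (tensorSpaceToBaseChange ℂ V r 0 t)) → t ∈ Submodule.span ℚ {m : hodgeTensorSpace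 V r 0 | ∃ (j l : ℕ) (ε : Fin r ≃ (Fin 2 × Fin j) ⊕ Fin l) (τ : Fin j → Fin p) (z : Fin l → V) (_ : ∀ a, s (z a) = z a), m = (∑ w : Fin r → Fin (Module.finrank ℚ V), ((∏ c : Fin j, (LinearMap.toMatrix (Module.finBasis ℚ V) (Module.finBasis ℚ V) (s ^ ((τ c : Fin p) : ℕ)) * (Matrix.of fun a a' => Q ((Module.finBasis ℚ V) a) ((Module.finBasis ℚ V) a'))⁻¹) (w (ε.symm (Sum.inl (0, c)))) (w (ε.symm (Sum.inl (1, c))))) * ∏ a : Fin l, ((Module.finBasis ℚ V).repr (z a)) (w (ε.symm (Sum.inr a)))) • ((PiTensorProduct.tprod ℚ fun i => (Module.finBasis ℚ V) (w i)) ⊗ₜ[ℚ] (PiTensorProduct.tprod ℚ fun i : Fin 0 => (Fin.elim0 i : Module.Dual ℚ V))))} := by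
  intro V _ _ _ Q s p hp h3 hQn hQs hsp hsQ h1 r t hU
  classical
  -- §A: the complexified setting
  have hp0 : 0 < p := hp.pos
  have hodd : Odd p := hp.odd_of_ne_two (by omega)
  have hph : p = 2 * (p / 2) + 1 := by obtain ⟨m, hm⟩ := hodd; omega
  have hσ : (s.baseChange ℂ) ^ p = 1 := baseChange_pow_eq_one s hsp
  have hB : ∀ x y, Q.baseChange ℂ (s.baseChange ℂ x) (s.baseChange ℂ y) = Q.baseChange ℂ x y :=
    baseChange_isometry Q s hsQ
  have hBs : ∀ x y, Q.baseChange ℂ x y = Q.baseChange ℂ y x := baseChange_symm Q hQs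
  have hBn : (Q.baseChange ℂ).Nondegenerate := baseChange_nondegenerate Q hQn
  obtain ⟨ζ, hζ⟩ : ∃ ζ : ℂ, IsPrimitiveRoot ζ p := ⟨_, Complex.isPrimitiveRoot_exp p hp.ne_zero⟩
  have hn : ∀ j, 1 ≤ j → j < p → Module.finrank ℂ ↥(E (s.baseChange ℂ) ζ p j) =
      Module.finrank ℂ ↥(E (s.baseChange ℂ) ζ p 1) := fun j hj1 hjp =>
    finrank_range_specProj_eq s hσ hζ hp0 (Nat.Coprime.symm (Nat.coprime_of_lt_prime (by omega) hjp hp))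
  obtain ⟨v₀, hv₀, hsv, hgen'⟩ := exists_generator_of_finrank_eigenspace_eq_one s hp0 hsp h1
  have hx₀ : ((1 : ℂ) ⊗ₜ[ℚ] v₀ : ℂ ⊗[ℚ] V) ≠ 0 := one_tmul_ne_zero hv₀
  have hE0 : ∀ x : ℂ ⊗[ℚ] V, x ∈ E (s.baseChange ℂ) ζ p 0 ↔ s.baseChange ℂ x = x := by
    intro x
    change x ∈ LinearMap.range (specProj (s.baseChange ℂ) ζ p 0) ↔ _
    rw [range_specProj hσ hζ hp0 0, pow_zero, Module.End.mem_eigenspace_iff, one_smul]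
  have hx₀E : ((1 : ℂ) ⊗ₜ[ℚ] v₀ : ℂ ⊗[ℚ] V) ∈ E (s.baseChange ℂ) ζ p 0 := by
    rw [hE0, LinearMap.baseChange_tmul, hsv]
  have hgen : ∀ x ∈ E (s.baseChange ℂ) ζ p 0, ∃ c : ℂ, x = c • ((1 : ℂ) ⊗ₜ[ℚ] v₀) :=
    fun x hx => hgen' x ((hE0 x).mp hx)
  -- §B/§C: the FFT in the eigen-adapted basis
  set x := tensorSpaceToBaseChange ℂ V r 0 t with hxdef
  have hfix : ∀ γ ∈ centIso (s.baseChange ℂ) (Q.baseChange ℂ), tensorSpaceActOver γ x = x :=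
    fun γ hγ => hU γ hγ.1 hγ.2.1 hγ.2.2
  have hspan := mem_span_pairTensor (adaptedBasis hσ hζ hp0 hph hB hBn hn hx₀ hx₀E hgen) x fun i g =>
    ⟨glElem hσ hζ hp0 hph hB hBn hn i g,
      ⟨glElem_vec hσ hζ hp0 hph hB hBn hn hx₀ hx₀E hgen i g, glElem_cov hσ hζ hp0 hph hB hBn hn hx₀ hx₀E hgen i g,
        glElem_none hσ hζ hp0 hph hB hBn hn hx₀ hx₀E hgen i g,
        fun i' hi' b a => glElem_other hσ hζ hp0 hph hB hBn hn hx₀ hx₀E hgen i g hi' b a⟩,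
      hfix _ (glElem_mem_centIso hσ hζ hp0 hph hB hBn hBs hn i g)⟩
  -- §E: pair tensors are complex combinations of complexified matching tensors
  have hx : x ∈ Submodule.span ℂ (tensorSpaceToBaseChange ℂ V r 0 ''
      {m : hodgeTensorSpace V r 0 | ∃ (j l : ℕ) (ε : Fin r ≃ (Fin 2 × Fin j) ⊕ Fin l) (τ : Fin j → Fin p)
        (z : Fin l → V) (_ : ∀ a, s (z a) = z a), m = matchingTensor Q s p r j l ε τ z}) := by
    refine Submodule.span_le.mpr ?_ hspan
    rintro _ ⟨κ, β, hβ, rfl⟩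
    exact pairTensor_mem_span Q s hσ hζ hp0 hph hB hBn hBs hQn hn hx₀ hx₀E hgen κ (stdEnum κ) β hβ hsv
  -- §F: descent to `ℚ`
  have ht : t ∈ Submodule.span ℚ {m : hodgeTensorSpace V r 0 | ∃ (j l : ℕ) (ε : Fin r ≃ (Fin 2 × Fin j) ⊕ Fin l)
      (τ : Fin j → Fin p) (z : Fin l → V) (_ : ∀ a, s (z a) = z a), m = matchingTensor Q s p r j l ε τ z} := by
    refine mem_of_tensorSpaceToBaseChange_mem_subspaceBaseChange (V := V) _ ?_
    rw [subspaceBaseChange_eq_span]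
    exact Submodule.span_mono (Set.image_mono Submodule.subset_span) hx
  exact ht

end Summit.HodgeConjecture.HodgeConjecture.Theorems.CyclicUnitaryPowersDeckUnitaryInvariantsMatching

end
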